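import Mathlib.NumberTheory.Chebyshev
import Mathlib.NumberTheory.AbelSummation
import Mathlib.MeasureTheory.Integral.IntervalIntegral.IntegrationByParts
import Literature.NumberTheory.LFunctions.PrimeSquareTail
import HarnessLib

/-!
# Sums of a smooth weight over primes against `dt`: Abel summation through `ϑ`

Topic `Literature/NumberTheory/LFunctions`. Everything here is PROVED (no definitions, no named
facts). For a weight `f ∈ C¹[a, b]` (`0 ≤ a ≤ b`) Abel summation with the coefficients
`[p prime] log p` (summatory function `ϑ`) followed by an integration by parts gives the exact
identity

`∑_{a < p ≤ b} f(p) log p − ∫_a^b f(t) dt = f(b) E(b) − f(a) E(a) − ∫_a^b f'(t) E(t) dt`,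
`E(t) = ϑ(t) − t`

(`sum_prime_mul_log_sub_integral_eq`; the sum runs over the primes in `(⌊a⌋, ⌊b⌋]`), and, for any
`C` with `|E(t)| ≤ C t/log² t` for `t ≥ 2` (supplied by the tree's PROVED prime number theorem with
the de la Vallée Poussin error term, `ChebyshevThetaDeLaValleePoussin_holds.logPow 2`, packaged as
`Literature.NumberTheory.LFunctions.exists_abs_theta_sub_self_le_div_log_sq` in `MidpointSieveGain.lean`),
the bound

`|∑_{a < p ≤ b} f(p) log p − ∫_a^b f| ≤ |f(b)| C b/log² b + |f(a)| C a/log² a + ∫_a^b |f'(t)| C t/log² t dt`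

(`abs_sum_prime_mul_log_sub_integral_le`, `2 ≤ a ≤ b`). This is the standard device
"`∑_p g(p) = ∫ g(t) dt/log t + O(…)`" (Montgomery–Vaughan, *Multiplicative Number Theory I*, §2.1 and
the proof of Theorem 2.7) in the form consumed by the rough-number asymptotics of
`Literature/NumberTheory/Sieve/RoughNumbersBuchstab*.lean`; the three standard weights `1/log t`
(prime counts), `1/(t log t)` (`∑ 1/p`) and `t/log² t` (`∑ p/log p`) are worked out in
`PrimeSumStandardWeights.lean`.

## References

* H. L. Montgomery, R. C. Vaughan, *Multiplicative Number Theory I. Classical Theory*, CUP 2007,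
  §2.1 (Abel summation) and Theorem 6.9 (the error term). [MontgomeryVaughan2007]
-/

open Finset Real MeasureTheory Set intervalIntegral
open scoped Chebyshev

noncomputable section

namespace Literature.NumberTheory.LFunctions

/-- **Abel summation through `ϑ` and integration by parts.** For `0 ≤ a ≤ b` and `f` with a
continuous derivative `f'` on `[a, b]`,
`∑_{⌊a⌋ < p ≤ ⌊b⌋} f(p) log p − ∫_a^b f = f(b)(ϑ(b) − b) − f(a)(ϑ(a) − a) − ∫_a^b f'(t)(ϑ(t) − t) dt`.
[cite: MontgomeryVaughan2007, §2.1 (Abel summation)] -/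
theorem sum_prime_mul_log_sub_integral_eq {f f' : ℝ → ℝ} {a b : ℝ} (ha : 0 ≤ a) (hab : a ≤ b)
    (hf : ∀ t ∈ Icc a b, HasDerivAt f (f' t) t) (hf' : ContinuousOn f' (Icc a b)) :
    ∑ p ∈ (Finset.Ioc ⌊a⌋₊ ⌊b⌋₊).filter Nat.Prime, f p * Real.log p - ∫ t in a..b, f t =
      f b * (θ b - b) - f a * (θ a - a) - ∫ t in a..b, f' t * (θ t - t) := by
  set c : ℕ → ℝ := fun k => if k.Prime then Real.log k else 0 with hc
  have hderiv : ∀ t ∈ Icc a b, deriv f t = f' t := fun t ht => (hf t ht).deriv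
  have hf_diff : ∀ t ∈ Icc a b, DifferentiableAt ℝ f t := fun t ht => (hf t ht).differentiableAt
  have hf'_int : IntegrableOn f' (Icc a b) := hf'.integrableOn_Icc
  have hderiv_int : IntegrableOn (deriv f) (Icc a b) :=
    hf'_int.congr_fun (fun t ht => (hderiv t ht).symm) measurableSet_Icc
  have habel := sum_mul_eq_sub_sub_integral_mul c ha hab hf_diff hderiv_int
  simp only [hc, PrimeSquareTail.sum_Icc_ite_prime_log] at habel
  -- the left-hand side of Abel's identity is the prime sum
  have hlhs : ∑ k ∈ Finset.Ioc ⌊a⌋₊ ⌊b⌋₊, f k * (if k.Prime then Real.log k else 0) =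
      ∑ p ∈ (Finset.Ioc ⌊a⌋₊ ⌊b⌋₊).filter Nat.Prime, f p * Real.log p := by
    rw [Finset.sum_filter]
    refine Finset.sum_congr rfl fun k _ => ?_
    split_ifs <;> simp
  -- the integral in Abel's identity
  have hint_eq : ∫ t in Ioc a b, deriv f t * θ t = ∫ t in a..b, f' t * θ t := by
    rw [intervalIntegral.integral_of_le hab]
    refine setIntegral_congr_fun measurableSet_Ioc fun t ht => ?_
    rw [hderiv t (Ioc_subset_Icc_self ht)]
  -- integration by parts `∫ f = b f(b) − a f(a) − ∫ t f'(t) dt`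
  have huIcc : uIcc a b = Icc a b := uIcc_of_le hab
  have hf'_ii : IntervalIntegrable f' volume a b := (hf'.mono huIcc.subset).intervalIntegrable
  have hIBP : ∫ t in a..b, f t = f b * b - f a * a - ∫ t in a..b, f' t * t := by
    have h := intervalIntegral.integral_mul_deriv_eq_deriv_mul (u := f) (v := id) (u' := f')
      (v' := fun _ => (1 : ℝ)) (fun t ht => hf t (huIcc ▸ ht)) (fun t _ => hasDerivAt_id t)
      hf'_ii intervalIntegrable_const
    simpa only [id, mul_one] using h
  -- integrability of `f' ϑ` and `f' · t`
  have hθ_int : IntervalIntegrable (fun t => f' t * θ t) volume a b := by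
    rw [intervalIntegrable_iff_integrableOn_Icc_of_le hab]
    have h := integrableOn_mul_sum_Icc c ha (m := 0) hf'_int
    simp only [hc, PrimeSquareTail.sum_Icc_ite_prime_log] at h
    exact h
  have hid_int : IntervalIntegrable (fun t => f' t * t) volume a b :=
    ((hf'.mul continuousOn_id).mono huIcc.subset).intervalIntegrable
  have hsplit : ∫ t in a..b, f' t * (θ t - t) =
      (∫ t in a..b, f' t * θ t) - ∫ t in a..b, f' t * t := by
    rw [← intervalIntegral.integral_sub hθ_int hid_int]
    refine intervalIntegral.integral_congr fun t _ => ?_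
    ring
  rw [hlhs, hint_eq] at habel
  rw [habel, hIBP, hsplit]
  ring

/-- **The prime sum against `dt` with the PNT error term.** For `2 ≤ a ≤ b`, `f ∈ C¹[a, b]` and
any `C` with `|ϑ(t) − t| ≤ C t/log² t` (`t ≥ 2`):
`|∑_{⌊a⌋ < p ≤ ⌊b⌋} f(p) log p − ∫_a^b f| ≤ |f(b)| C b/log² b + |f(a)| C a/log² a + ∫_a^b |f'(t)| C t/log² t dt`.
[cite: MontgomeryVaughan2007, §2.1 (Abel summation)] -/
theorem abs_sum_prime_mul_log_sub_integral_le {f f' : ℝ → ℝ} {a b C : ℝ} (ha : 2 ≤ a)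
    (hab : a ≤ b) (hf : ∀ t ∈ Icc a b, HasDerivAt f (f' t) t) (hf' : ContinuousOn f' (Icc a b))
    (hE : ∀ t : ℝ, 2 ≤ t → |θ t - t| ≤ C * t / Real.log t ^ 2) :
    |∑ p ∈ (Finset.Ioc ⌊a⌋₊ ⌊b⌋₊).filter Nat.Prime, f p * Real.log p - ∫ t in a..b, f t| ≤
      |f b| * (C * b / Real.log b ^ 2) + |f a| * (C * a / Real.log a ^ 2) +
        ∫ t in a..b, |f' t| * (C * t / Real.log t ^ 2) := by
  rw [sum_prime_mul_log_sub_integral_eq (by linarith) hab hf hf']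
  have huIcc : uIcc a b = Icc a b := uIcc_of_le hab
  have hf'_int : IntegrableOn f' (Icc a b) := hf'.integrableOn_Icc
  -- integrability of `f' E` and of the majorant
  have hθ_int : IntervalIntegrable (fun t => f' t * θ t) volume a b := by
    rw [intervalIntegrable_iff_integrableOn_Icc_of_le hab]
    have h := integrableOn_mul_sum_Icc (fun k : ℕ => if k.Prime then Real.log k else 0)
      (by linarith : (0 : ℝ) ≤ a) (m := 0) hf'_int
    simp only [PrimeSquareTail.sum_Icc_ite_prime_log] at h
    exact h
  have hid_int : IntervalIntegrable (fun t => f' t * t) volume a b :=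
    ((hf'.mul continuousOn_id).mono huIcc.subset).intervalIntegrable
  have hE_int : IntervalIntegrable (fun t => f' t * (θ t - t)) volume a b := by
    have : (fun t => f' t * (θ t - t)) = fun t => f' t * θ t - f' t * t := by funext t; ring
    rw [this]
    exact hθ_int.sub hid_int
  have hmaj_cont : ContinuousOn (fun t => |f' t| * (C * t / Real.log t ^ 2)) (Icc a b) := by
    refine (continuous_abs.comp_continuousOn hf').mul ?_
    refine ContinuousOn.div (continuousOn_const.mul continuousOn_id)
      ((continuousOn_log.mono ?_).pow 2) ?_
    · intro t ht; exact ne_of_gt (show (0 : ℝ) < t by linarith [ht.1])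
    · intro t ht; exact pow_ne_zero 2 (Real.log_pos (by linarith [ht.1])).ne'
  have hmaj_int : IntervalIntegrable (fun t => |f' t| * (C * t / Real.log t ^ 2)) volume a b :=
    (hmaj_cont.mono huIcc.subset).intervalIntegrable
  -- the three terms
  have h1 : |f b * (θ b - b)| ≤ |f b| * (C * b / Real.log b ^ 2) := by
    rw [abs_mul]; exact mul_le_mul_of_nonneg_left (hE b (ha.trans hab)) (abs_nonneg _)
  have h2 : |f a * (θ a - a)| ≤ |f a| * (C * a / Real.log a ^ 2) := by
    rw [abs_mul]; exact mul_le_mul_of_nonneg_left (hE a ha) (abs_nonneg _)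
  have h3 : |∫ t in a..b, f' t * (θ t - t)| ≤ ∫ t in a..b, |f' t| * (C * t / Real.log t ^ 2) := by
    refine (intervalIntegral.abs_integral_le_integral_abs hab).trans ?_
    refine intervalIntegral.integral_mono_on hab hE_int.abs hmaj_int fun t ht => ?_
    rw [abs_mul]
    exact mul_le_mul_of_nonneg_left (hE t (ha.trans ht.1)) (abs_nonneg _)
  calc |f b * (θ b - b) - f a * (θ a - a) - ∫ t in a..b, f' t * (θ t - t)|
      ≤ |f b * (θ b - b)| + |f a * (θ a - a)| + |∫ t in a..b, f' t * (θ t - t)| := by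
        have := abs_sub (f b * (θ b - b)) (f a * (θ a - a))
        have := abs_sub (f b * (θ b - b) - f a * (θ a - a)) (∫ t in a..b, f' t * (θ t - t))
        linarith
    _ ≤ _ := by linarith


end Literature.NumberTheory.LFunctions
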